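import Summits.BirchSwinnertonDyer.BirchSwinnertonDyer.Theorems.Rank1ResidualJetCarrierEndFormsSwapLiterature
import Summits.BirchSwinnertonDyer.BirchSwinnertonDyer.Theorems.Rank1ResidualJetSwapLevelRaisingLiterature
import HarnessLib

/-!
# T1 JET (cell `bsd-jet`), road K — McCallum 1991 Prop. 5.2 (`h52`) STRUCK: the END FORMS
# K3 ∕ K1 ∕ K4 ⟸ THREE named Literature statements {Poitou–Tate for Selmer structures, F1 = [GZ86 III
# (3.1)] ∕ Gross 1991 §6, (γ) = Gross 1991 Prop. 3.7 (2) image-free} — NO McCallum 5.2, NO reading binder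

HONEST FRAMING (programme file `BSD-LIT2PART-PROGRAMME-v1.md` §HONESTY, verbatim): «no tranche here
proves BSD; ARM L moves the LITERAL column of an r ≤ 1 census into the kernel-proved-modulo-named-print
column; ARM P changes what «named print» is worth.» THEOREMS ONLY (seat `bsd-jet-pv-2`, session g6;
`--supports stmt-BirchSwinnertonDyer-14418`, helper); nothing is booked, no flag is struck by this
file, 0 classes move (road K is DOCUMENTARY); K1 ∕ K3 ∕ K4 stay `@[conjecture]`, here PROVED modulo the
three named statements.

WHAT. Three one-line compositions: brick 6c `jetchevDivisibilityCarrier{Mult,Ne,Add}_of_levelRaisingLiterature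
hR hPT hF1 h372` with `hR := Swap.levelRaising_of_literature hPT hF1 h372` (brick 7: Kolyvagin's
prime-swap walk in the kernel — bricks 1–4, 8, 2b′ — with every structural input supplied by name).
ROAD-K RESIDUAL AFTER THIS FILE, BY NAME — THREE Literature `def … : Prop` statements, all PUBLISHED:
`poitouTate_selmerStructure_duality_conj` (Poitou–Tate for Selmer structures, conjugation form),
`Gross1991_heegnerPoint_sub_ratTorsion_mem_E0` (F1: [GZ86 III (3.1)] as Gross 1991 §6 uses it),
`GrossLMS1991.prop37_2_frobeniusCongruence` ((γ), image-free). McCallum 1991 Prop. 5.2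
(`McCallum1991.prop52_exists_conductor_kolyvaginClass_order_eq`, pv-1 g8's fourth statement) is NO
LONGER an input: its only use (level raising at minimal depth in the §6 bridge) is the kernel theorem
`Swap.exists_conductor_levelIndex_ge_of_minDepth`. READING NOTE: McCallum's printed proof of Prop. 5.2
(LMS LN 153, p. 306, sum (13) with the level-`p` class of Lemma 5.3) is right only for the DIVIDED
classes `[P_n / p^{M_r}]` ([Kol91b]); the kernel walk runs at level `p` on the root classes and uses
minimality of `m_∞` over ALL conductors (no `r`-bookkeeping, no `y_K`-of-infinite-order at the bridge).
References: [cite: Jetchev2008, Thm. 1.4 (p. 812), Thm. 5.2, Prop. 4.9, Prop. 5.3, Proof of Thm. 1.1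
(pp. 820–824)] [cite: McCallumLMS1991, §4 Prop. 4.4, §5 Prop. 5.2 and proof (pp. 304–306)]
[cite: GrossLMS1991, Prop. 3.7 (2), §6 Prop. 6.2 (1)] [cite: GrossZagier1986, III (3.1)]
[cite: MilneADT2006, Ch. I, Thm. 4.10(b)].
-/

set_option autoImplicit false

noncomputable section

open scoped Classical

open WeierstrassCurve IsDedekindDomain NumberField Field Literature.NumberTheory.EllipticCurves
  Literature.NumberTheory.EllipticCurves.ModularForms Literature.NumberTheory.EllipticCurves.Jetchev2008
  Literature.NumberTheory.EllipticCurves.KolyvaginCocycle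
  Literature.NumberTheory.GaloisRepresentations Literature.NumberTheory.GaloisCohomology
  Literature.NumberTheory.GaloisRepresentations.DiscreteGaloisModule
  Summit.BirchSwinnertonDyer.Rank1Residual.X11b Summit.BirchSwinnertonDyer.Rank1Residual.X11b.Three
  Summit.BirchSwinnertonDyer.Rank1Residual.JET.SelmerVocabulary Literature.NumberTheory.Automorphic
  Summit.BirchSwinnertonDyer.BirchSwinnertonDyer.Theorems

namespace Summit.BirchSwinnertonDyer.Rank1Residual.JET

/-- **K3 ⟸ three named Literature statements** (multiplicative carrier `p ∣ N`): {Poitou–Tate for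
Selmer structures, F1, (γ) Gross Prop. 3.7 (2) image-free} — McCallum 5.2 replaced by the kernel walk.
[cite: Jetchev2008, Thm. 1.4, Thm. 5.2, Prop. 4.9, Prop. 5.3] [cite: McCallumLMS1991, Prop. 4.4, Prop. 5.2]
[cite: GrossLMS1991, Prop. 3.7, §6] [cite: GrossZagier1986, III (3.1)] -/
theorem jetchevDivisibilityCarrierMult_of_swapLiterature
    (hPT : ∀ (K : Type) [Field K] [NumberField K], poitouTate_selmerStructure_duality_conj K)
    (hF1 : Gross1991_heegnerPoint_sub_ratTorsion_mem_E0)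
    (h372 : GrossLMS1991.prop37_2_frobeniusCongruence) :
    JetchevDivisibilityCarrierMult :=
  jetchevDivisibilityCarrierMult_of_levelRaisingLiterature (Swap.levelRaising_of_literature hPT hF1 h372)
    hPT hF1 h372

/-- **K1 ⟸ three named Literature statements** (carrier a prime `q ∣ N`, `q ≠ p`).
[cite: Jetchev2008, Thm. 1.4, Thm. 5.2, Prop. 4.9, Prop. 5.3] [cite: McCallumLMS1991, Prop. 4.4, Prop. 5.2]
[cite: GrossLMS1991, Prop. 3.7, §6] [cite: GrossZagier1986, III (3.1)] -/
theorem jetchevDivisibilityCarrierNe_of_swapLiterature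
    (hPT : ∀ (K : Type) [Field K] [NumberField K], poitouTate_selmerStructure_duality_conj K)
    (hF1 : Gross1991_heegnerPoint_sub_ratTorsion_mem_E0)
    (h372 : GrossLMS1991.prop37_2_frobeniusCongruence) :
    JetchevDivisibilityCarrierNe :=
  jetchevDivisibilityCarrierNe_of_levelRaisingLiterature (Swap.levelRaising_of_literature hPT hF1 h372)
    hPT hF1 h372

/-- **K4 ⟸ three named Literature statements** (carrier `p`, `E` additive at `p`).
[cite: Jetchev2008, Thm. 1.4, Thm. 5.2, Prop. 4.9, Prop. 5.3] [cite: McCallumLMS1991, Prop. 4.4, Prop. 5.2]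
[cite: GrossLMS1991, Prop. 3.7, §6] [cite: GrossZagier1986, III (3.1)] -/
theorem jetchevDivisibilityCarrierAdd_of_swapLiterature
    (hPT : ∀ (K : Type) [Field K] [NumberField K], poitouTate_selmerStructure_duality_conj K)
    (hF1 : Gross1991_heegnerPoint_sub_ratTorsion_mem_E0)
    (h372 : GrossLMS1991.prop37_2_frobeniusCongruence) :
    JetchevDivisibilityCarrierAdd :=
  jetchevDivisibilityCarrierAdd_of_levelRaisingLiterature (Swap.levelRaising_of_literature hPT hF1 h372)
    hPT hF1 h372

end Summit.BirchSwinnertonDyer.Rank1Residual.JET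

end
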